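import Summits.QuantumFields.YangMills.Theorems.BalabanUVNodesSpineRates
import Summits.QuantumFields.YangMills.Theorems.BalabanUVNodesN22KnitFiniteTower

/-!
# BalabanUVNodes ∕ node N22 = NE9 — THE «AT-RECORD» MODULE (plan word (W2)): the K4 stub `YMDAG.UVSplit.S_N22 RRec` of the route's tree-home
# module `BalabanUVNodesSpineRates` UNFOLDED, ANTITONE in the rate-record predicate, CLOSED for EVERY `RRec` carrying one of two slots — the
# abstract knit slot «(P) + (O) + (R₂)» (`BalabanUVNodesN22KnitDiscrete`) or the TOWER slot «the bundle is a level of ne9's tower of carriers and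
# node N18 holds at the lower levels» (`BalabanUVNodesN22KnitFiniteTower`: the K4-internal edge N18 → N22 of record) — GUARDED (the carrier's
# modulus field `Λ` decides; vacuity over an empty predicate), and the node's consumer faces AT THE RECORD

Cell `pub-ymgap`, HUMAN RULING D-0062 (Track A at full width), seat `pub-ymgap-dag-n22-a` (-a KNIT-BY-NAME), generation 2.  THEOREMS ONLY (no `def`,
no `def … : Prop`); imports the route's K4 module `YangMills/Theorems/BalabanUVNodesSpineRates.lean` (dagwriter text, courier dag-p2, p418381:
`U3Carriers`, `RateCarriers`, `RateRecordPred`, `N18At`, `N22At`, `RatesAt`, `S_N22`) and this seat's knit modules 1 ∕ 4 ∕ 6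
(`BalabanUVNodesN22Knit{,Discrete,FiniteTower}`) BY NAME.  `--supports stmt-QuantumFields-19182` (SpineGivenEndpoint; K4 = spine side).

HONEST FRAMING.  By-name bookkeeping; no `RRec` home exists in the tree (R422 (A)(P2): the rate-record predicate is a PARAMETER until NODE 00's
later-stage record predicate lands), so nothing here is a discharge of N22; NE5 ∕ NE9 NOT IN PRINT, NOT PROVED; instance on Bałaban's localized
`E^{(j)}(X)` 0∕1 (W1); count-neutral; one finite four-torus programme at fixed ε — NOT infinite volume, NOT OS on ℝ⁴, NOT a mass gap, NOT Clay.
0 `sorry`, 0 `def`, standard axioms.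

WHAT.
* §1 (W2) READINGS: `s_N22_iff` (`Iff.rfl`: the stub is «every rate bundle of record carries NE9 ∧ FadingMemory on its U3 sub-bundle»), `n22At_iff`,
  `s_N22_antitone` (closed under refinement of `RRec`), `ratesAt_n22` (N22 is the sixth conjunct of K4's per-string conclusion `RatesAt`).
* §2 (W2) CLOSERS, refinement-generic.  (a) THE ABSTRACT SLOT: `n22At_of_oscSecondDiff` — a U3 bundle whose window is `Window γ`, whose run-A
  functional has (P) prefix dependence, (O) oscillation fading at the bundle's own NE5 rate `θ` and (R₂) second differences with geometric growth
  `μ`, and whose modulus letters are the knit's (`Λ k i = C₉ω^{k−i}`, `C₉ = (4C₀∕γ + Mγ∕2)∕ω`, `θ ≤ ωρ`, `μρ ≤ ω`) carries `N22At`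
  (`N22KnitDiscrete.ne9_and_fadingMemory_of_osc_secondDiff` BY NAME); `s_N22_of_oscSecondDiff` — hence `S_N22 RRec` for EVERY `RRec` whose bundles
  carry that slot; `s_N22_of_refines`.  (b) THE TOWER SLOT (the K4-internal edge of record): `n22At_level_of_n18At_below` — the U3 bundle «level
  `k` of ne9's tower of carriers» (`C = T.level k`, `EA = E k`, `EB b = E (k+1) ∘ prepend b`, geometric `Λ`) carries `N22At` as soon as the
  bundles «level `k′`» for `k′ < k` carry `N18At` (node N18 BY NAME, the finite datum) and `E k` has (P) + (R₂)
  (`N22KnitFiniteTower.ne9_fadingMemory_at_level_of_ne5_below`); `s_N22_of_towerSlot` — `S_N22 RRec` for EVERY `RRec` whose bundles are tower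
  levels with N18 below and (P) + (R₂) at the level.  What an instancing `RRec` must therefore carry for N22 is SAID: (P) (printed words),
  (R₂) (the regularity letter — the located residual proper to N22, body-derived un-localised in `…N22KnitBodyTower`, localized = W1) and
  EITHER (O) OR the tower identification + N18 below.
* §3 (W2) GUARDS: `n22At_toy_unitModulus` (INHABITED rider: the history-reading functional `E g U X = g 0` at scale 1 with `Λ ≡ 1`, `ω = 1`
  carries `N22At` — the marginal regime), `not_n22At_toy_zeroModulus` (the same functional with `Λ ≡ 0` does NOT: the carrier's modulus field
  decides, so the slot is not vacuous), `not_s_N22_of_admits` (R422 at node level: a predicate admitting one bundle without `N22At` has no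
  `S_N22`), `s_N22_of_empty` (vacuity over an empty predicate — why the rider matters; K4's existence content is `S_R00x`).
* §4 FACES AT THE RECORD: `prefixDependence_at_record` (NE9 ⇒ the printed prefix dependence, `T4OutputRate.prefixDependenceOn_of_ne9`),
  `historyBracket_at_record` (the coupling bracket of `u3_threeBrackets` is bounded UNIFORMLY in the creation step when `ω < 1`,
  `T4OutputRate.historySum_le_of_fadingMemory` — what N19's coupling bracket consumes), `fadingMemory_nonneg_at_record`.

References (TYPES only): [Balaban1987RG1] = T. Bałaban, Commun. Math. Phys. **109** (1987) 249–301 — p. 256 (prefix dependence, words), Thm 1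
p. 259, (1.18) and the C^∞ clause p. 263, p. 298.
-/

noncomputable section

namespace YMDAG.N22

open Set
open scoped BigOperators
open Literature.MathematicalPhysics.QuantumFieldTheory.Balaban1983to89
open Literature.MathematicalPhysics.QuantumFieldTheory.Balaban1983to89.T4Continuum
open Literature.MathematicalPhysics.QuantumFieldTheory.Balaban1983to89.T4OutputRate
open Summit.QuantumFields.BalabanUV.T4Continuum.NE9.TowerCarriers (TowerData prepend)
open Summit.QuantumFields.YangMills.BalabanUVNodes.N22KnitDiscrete (ne9_and_fadingMemory_of_osc_secondDiff)
open Summit.QuantumFields.YangMills.BalabanUVNodes.N22KnitFiniteTower (ne9_fadingMemory_at_level_of_ne5_below)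
open YMDAG.UVSplit

variable {N : ℕ} [NeZero N]

/-! ## §1 (W2) readings: the stub unfolded, antitone in `RRec`, and its place in K4's per-string conclusion -/

/-- **`S_N22` UNFOLDED** (`Iff.rfl`): every rate bundle of record carries, on its U3 sub-bundle, the joint history-Lipschitz bound NE9 of run A's
functional with the bundle's moduli `Λ` AND their fading memory with letters `C₉, ω`. [folklore] -/
theorem s_N22_iff (RRec : RateRecordPred N) :
    S_N22 RRec ↔ ∀ (F : T4Family) (D : Datum F N) (g₀ : ℕ → ℝ) (os : List (ULoop F)) (R : RateCarriers N),
      RRec F D g₀ os R → NE9 R.u3.EA R.u3.W R.u3.κ R.u3.Λ ∧ FadingMemory R.u3.C₉ R.u3.ω R.u3.Λ :=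
  Iff.rfl

/-- `N22At` UNFOLDED (`Iff.rfl`). [folklore] -/
theorem n22At_iff (u : U3Carriers) : N22At u ↔ NE9 u.EA u.W u.κ u.Λ ∧ FadingMemory u.C₉ u.ω u.Λ := Iff.rfl

/-- **`S_N22` IS ANTITONE IN THE RATE-RECORD PREDICATE**: a refinement of `RRec` (fewer bundles of record) inherits the closer. [folklore] -/
theorem s_N22_antitone {RRec RRec' : RateRecordPred N}
    (href : ∀ (F : T4Family) (D : Datum F N) (g₀ : ℕ → ℝ) (os : List (ULoop F)) (R : RateCarriers N), RRec' F D g₀ os R → RRec F D g₀ os R)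
    (h : S_N22 RRec) : S_N22 RRec' :=
  fun F D g₀ os R hR => h F D g₀ os R (href F D g₀ os R hR)

/-- N22 is the sixth conjunct of K4's per-string conclusion `RatesAt`. [folklore] -/
theorem ratesAt_n22 {F : T4Family} {D : Datum F N} {R : RateCarriers N} (h : RatesAt D R) : N22At R.u3 := h.2.2.2.2.2

/-! ## §2 (W2) closers, refinement-generic -/

/-- **(a) THE ABSTRACT SLOT CARRIES `N22At`.**  A U3 bundle with window `Window γ`, (P) prefix dependence of run A's functional, (O) oscillation fading
with constant `C₀` at the bundle's NE5 rate `θ`, (R₂) second differences of every young-coupling section on `]0, γ]` bounded by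
`M·μ^{age−1}·e^{−κd(X)}·d²`, a step ratio `ρ ∈ ]0, 1]` with `θ ≤ ωρ`, `μρ ≤ ω`, `ω > 0`, and modulus letters `Λ k i = C₉·ω^{k−i}`,
`C₉ = (4C₀∕γ + Mγ∕2)∕ω` carries `N22At` — `N22KnitDiscrete.ne9_and_fadingMemory_of_osc_secondDiff` BY NAME. [folklore] -/
theorem n22At_of_oscSecondDiff (u : U3Carriers) {C₀ M μ ρ : ℝ} (hW : u.W = Window u.γ)
    (hP : PrefixDependenceOn u.EA (Window u.γ))
    (hO : ∀ g ∈ Window u.γ, ∀ g' ∈ Window u.γ, ∀ (U : u.C.BgA) (X : u.C.Dom) (a : ℕ), a ≤ u.C.scale X →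
      (∀ n, a ≤ n → g n = g' n) → |u.EA g U X - u.EA g' U X| ≤ C₀ * u.θ ^ (u.C.scale X - a) * Real.exp (-(u.κ * u.C.d X)))
    (hR2 : ∀ g ∈ Window u.γ, ∀ (U : u.C.BgA) (X : u.C.Dom) (i : ℕ), i < u.C.scale X → ∀ t d : ℝ, 0 < d →
      t - d ∈ Ioc (0 : ℝ) u.γ → t + d ∈ Ioc (0 : ℝ) u.γ →
        |u.EA (Function.update g i (t + d)) U X - 2 * u.EA (Function.update g i t) U X + u.EA (Function.update g i (t - d)) U X| ≤
          M * μ ^ (u.C.scale X - 1 - i) * Real.exp (-(u.κ * u.C.d X)) * d ^ 2)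
    (hC₀ : 0 ≤ C₀) (hθ0 : 0 ≤ u.θ) (hM : 0 ≤ M) (hμ : 0 ≤ μ) (hγ : 0 < u.γ) (hρ0 : 0 < ρ) (hρ1 : ρ ≤ 1)
    (hθωρ : u.θ ≤ u.ω * ρ) (hμρω : μ * ρ ≤ u.ω) (hω0 : 0 < u.ω)
    (hΛ : u.Λ = fun k i => u.C₉ * u.ω ^ (k - i)) (hC₉ : u.C₉ = (4 * C₀ / u.γ + M * u.γ / 2) / u.ω) :
    N22At u := by
  show NE9 u.EA u.W u.κ u.Λ ∧ FadingMemory u.C₉ u.ω u.Λ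
  rw [hW, hΛ, hC₉]
  exact ne9_and_fadingMemory_of_osc_secondDiff hP hO hR2 hC₀ hθ0 hM hμ hγ hρ0 hρ1 hθωρ hμρω hω0

/-- **`S_N22 RRec` FOR EVERY `RRec` WHOSE BUNDLES CARRY THE ABSTRACT SLOT** (refinement-generic closer (a)). [folklore] -/
theorem s_N22_of_oscSecondDiff (RRec : RateRecordPred N)
    (hslot : ∀ (F : T4Family) (D : Datum F N) (g₀ : ℕ → ℝ) (os : List (ULoop F)) (R : RateCarriers N), RRec F D g₀ os R →
      ∃ C₀ M μ ρ : ℝ, R.u3.W = Window R.u3.γ ∧ PrefixDependenceOn R.u3.EA (Window R.u3.γ) ∧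
        (∀ g ∈ Window R.u3.γ, ∀ g' ∈ Window R.u3.γ, ∀ (U : R.u3.C.BgA) (X : R.u3.C.Dom) (a : ℕ), a ≤ R.u3.C.scale X →
          (∀ n, a ≤ n → g n = g' n) →
            |R.u3.EA g U X - R.u3.EA g' U X| ≤ C₀ * R.u3.θ ^ (R.u3.C.scale X - a) * Real.exp (-(R.u3.κ * R.u3.C.d X))) ∧
        (∀ g ∈ Window R.u3.γ, ∀ (U : R.u3.C.BgA) (X : R.u3.C.Dom) (i : ℕ), i < R.u3.C.scale X → ∀ t d : ℝ, 0 < d →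
          t - d ∈ Ioc (0 : ℝ) R.u3.γ → t + d ∈ Ioc (0 : ℝ) R.u3.γ →
            |R.u3.EA (Function.update g i (t + d)) U X - 2 * R.u3.EA (Function.update g i t) U X +
                R.u3.EA (Function.update g i (t - d)) U X| ≤
              M * μ ^ (R.u3.C.scale X - 1 - i) * Real.exp (-(R.u3.κ * R.u3.C.d X)) * d ^ 2) ∧
        0 ≤ C₀ ∧ 0 ≤ R.u3.θ ∧ 0 ≤ M ∧ 0 ≤ μ ∧ 0 < R.u3.γ ∧ 0 < ρ ∧ ρ ≤ 1 ∧ R.u3.θ ≤ R.u3.ω * ρ ∧ μ * ρ ≤ R.u3.ω ∧ 0 < R.u3.ω ∧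
        (R.u3.Λ = fun k i => R.u3.C₉ * R.u3.ω ^ (k - i)) ∧ R.u3.C₉ = (4 * C₀ / R.u3.γ + M * R.u3.γ / 2) / R.u3.ω) :
    S_N22 RRec := by
  intro F D g₀ os R hR
  obtain ⟨C₀, M, μ, ρ, hW, hP, hO, hR2, hC₀, hθ0, hM, hμ, hγ, hρ0, hρ1, hθωρ, hμρω, hω0, hΛ, hC₉⟩ := hslot F D g₀ os R hR
  exact n22At_of_oscSecondDiff R.u3 hW hP hO hR2 hC₀ hθ0 hM hμ hγ hρ0 hρ1 hθωρ hμρω hω0 hΛ hC₉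

/-- **THE REFINEMENT-GENERIC CLOSER**: if the slot holds along `RRec₀` and `RRec` refines `RRec₀`, then `S_N22 RRec` (one application of a refinement
lemma — the shape the rev-1 `closes` consumes). [folklore] -/
theorem s_N22_of_refines (RRec₀ RRec : RateRecordPred N) (h₀ : S_N22 RRec₀)
    (href : ∀ (F : T4Family) (D : Datum F N) (g₀ : ℕ → ℝ) (os : List (ULoop F)) (R : RateCarriers N), RRec F D g₀ os R → RRec₀ F D g₀ os R) :
    S_N22 RRec :=
  s_N22_antitone href h₀

/-- **(b) THE TOWER SLOT — THE K4-INTERNAL EDGE N18 → N22 OF RECORD.**  On ne9's tower of carriers `T` with level functionals `E k`, the U3 bundle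
«level `k`» — `C = T.level k`, window `Window γ`, `EA = E k`, `EB b = E (k+1) ∘ prepend b`, NE5 letters `θ, C₅`, moduli `Λ a i = C₉·τ^{a−i}` with
`C₉ = (4·(2C₅∕(1−θ))∕γ + Mγ∕2)∕τ`, fading letter `ω = τ` — carries `N22At` as soon as the bundles «level `k′`» for `k′ < k` carry `N18At` (node
N18 BY NAME at the run lengths below: the finite datum a `k`-step record has), `E k` has (P) prefix dependence and the letter (R₂) with constants
`M·μ^{age−1}·e^{−κd}`, and `ρ ∈ ]0, 1]`, `θ ≤ τρ`, `μρ ≤ τ`, `τ > 0` (`N22KnitFiniteTower.ne9_fadingMemory_at_level_of_ne5_below` BY NAME). [folklore] -/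
theorem n22At_level_of_n18At_below (T : TowerData) (E : ℕ → (ℕ → ℝ) → T.B → T.Dom → ℝ) {γ κ θ C₅ M μ ρ τ cr ρ' : ℝ}
    (hC : 0 ≤ C₅) (hθ0 : 0 ≤ θ) (hθ1 : θ < 1) (k : ℕ)
    (h18 : ∀ k' : ℕ, k' < k →
      N18At ⟨T.level k', Window γ, γ, κ, E k', fun b g U X => E (k' + 1) (prepend b g) U X, θ, C₅,
        fun a i => (4 * (2 * C₅ / (1 - θ)) / γ + M * γ / 2) / τ * τ ^ (a - i), (4 * (2 * C₅ / (1 - θ)) / γ + M * γ / 2) / τ, τ, cr, ρ'⟩)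
    (hP : PrefixDependenceOn (C := T.level k) (E k) (Window γ))
    (hR2 : ∀ g ∈ Window γ, ∀ (U : (T.level k).BgA) (X : (T.level k).Dom) (i : ℕ), i < (T.level k).scale X →
      ∀ t d : ℝ, 0 < d → t - d ∈ Ioc (0 : ℝ) γ → t + d ∈ Ioc (0 : ℝ) γ →
        |E k (Function.update g i (t + d)) U X - 2 * E k (Function.update g i t) U X + E k (Function.update g i (t - d)) U X| ≤
          M * μ ^ ((T.level k).scale X - 1 - i) * Real.exp (-(κ * (T.level k).d X)) * d ^ 2)
    (hM : 0 ≤ M) (hμ : 0 ≤ μ) (hγ : 0 < γ) (hρ0 : 0 < ρ) (hρ1 : ρ ≤ 1) (hθτρ : θ ≤ τ * ρ) (hμρτ : μ * ρ ≤ τ) (hτ0 : 0 < τ) :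
    N22At ⟨T.level k, Window γ, γ, κ, E k, fun b g U X => E (k + 1) (prepend b g) U X, θ, C₅,
      fun a i => (4 * (2 * C₅ / (1 - θ)) / γ + M * γ / 2) / τ * τ ^ (a - i), (4 * (2 * C₅ / (1 - θ)) / γ + M * γ / 2) / τ, τ, cr, ρ'⟩ := by
  have h5 : ∀ k' : ℕ, k' < k → ∀ b : ℝ, 0 < b → b ≤ γ →
      NE5 (C := T.level k') (E k') (fun g U X => E (k' + 1) (prepend b g) U X) (Window γ) κ θ C₅ :=
    fun k' hk' b hb0 hbγ => h18 k' hk' b hb0 hbγ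
  exact ne9_fadingMemory_at_level_of_ne5_below T hC hθ0 hθ1 k h5 hP hR2 hM hμ hγ hρ0 hρ1 hθτρ hμρτ hτ0

/-- **`S_N22 RRec` FOR EVERY `RRec` WHOSE BUNDLES CARRY THE TOWER SLOT** (refinement-generic closer (b)): every bundle of record IS a level of a
tower of carriers (with the letters of `n22At_level_of_n18At_below`), node N18 holds at the lower levels, and the level functional has (P) + (R₂).
[folklore] -/
theorem s_N22_of_towerSlot (RRec : RateRecordPred N)
    (hslot : ∀ (F : T4Family) (D : Datum F N) (g₀ : ℕ → ℝ) (os : List (ULoop F)) (R : RateCarriers N), RRec F D g₀ os R →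
      ∃ (T : TowerData) (E : ℕ → (ℕ → ℝ) → T.B → T.Dom → ℝ) (γ κ θ C₅ M μ ρ τ cr ρ' : ℝ) (k : ℕ),
        R.u3 = ⟨T.level k, Window γ, γ, κ, E k, fun b g U X => E (k + 1) (prepend b g) U X, θ, C₅,
          fun a i => (4 * (2 * C₅ / (1 - θ)) / γ + M * γ / 2) / τ * τ ^ (a - i), (4 * (2 * C₅ / (1 - θ)) / γ + M * γ / 2) / τ, τ, cr, ρ'⟩ ∧
        0 ≤ C₅ ∧ 0 ≤ θ ∧ θ < 1 ∧
        (∀ k' : ℕ, k' < k →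
          N18At ⟨T.level k', Window γ, γ, κ, E k', fun b g U X => E (k' + 1) (prepend b g) U X, θ, C₅,
            fun a i => (4 * (2 * C₅ / (1 - θ)) / γ + M * γ / 2) / τ * τ ^ (a - i), (4 * (2 * C₅ / (1 - θ)) / γ + M * γ / 2) / τ, τ, cr, ρ'⟩) ∧
        PrefixDependenceOn (C := T.level k) (E k) (Window γ) ∧
        (∀ g ∈ Window γ, ∀ (U : (T.level k).BgA) (X : (T.level k).Dom) (i : ℕ), i < (T.level k).scale X →
          ∀ t d : ℝ, 0 < d → t - d ∈ Ioc (0 : ℝ) γ → t + d ∈ Ioc (0 : ℝ) γ →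
            |E k (Function.update g i (t + d)) U X - 2 * E k (Function.update g i t) U X + E k (Function.update g i (t - d)) U X| ≤
              M * μ ^ ((T.level k).scale X - 1 - i) * Real.exp (-(κ * (T.level k).d X)) * d ^ 2) ∧
        0 ≤ M ∧ 0 ≤ μ ∧ 0 < γ ∧ 0 < ρ ∧ ρ ≤ 1 ∧ θ ≤ τ * ρ ∧ μ * ρ ≤ τ ∧ 0 < τ) :
    S_N22 RRec := by
  intro F D g₀ os R hR
  obtain ⟨T, E, γ, κ, θ, C₅, M, μ, ρ, τ, cr, ρ', k, hu, hC, hθ0, hθ1, h18, hP, hR2, hM, hμ, hγ, hρ0, hρ1, hθτρ, hμρτ, hτ0⟩ :=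
    hslot F D g₀ os R hR
  rw [hu]
  exact n22At_level_of_n18At_below T E hC hθ0 hθ1 k h18 hP hR2 hM hμ hγ hρ0 hρ1 hθτρ hμρτ hτ0

/-! ## §3 (W2) guards: the statement is inhabited; the carrier's modulus field decides; vacuity over an empty predicate -/

/-- **INHABITED rider**: the history-reading functional `E g U X = g 0` on one domain of scale `1` with moduli `Λ ≡ 1` and fading letters `C₉ = ω = 1`
carries `N22At` (the marginal regime: joint Lipschitz with a constant modulus). [folklore] -/
theorem n22At_toy_unitModulus :
    N22At ⟨⟨Unit, fun _ => 1, fun _ => 0, fun _ => le_rfl, Unit, Unit, fun _ _ => 0, fun _ _ => le_rfl, id⟩, Window 1, 1, 0,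
      fun g _ _ => g 0, fun _ g _ _ => g 0, 1 / 2, 0, fun _ _ => 1, 1, 1, 0, 1⟩ := by
  refine ⟨?_, ?_⟩
  · intro g _ g' _ U X
    show |g 0 - g' 0| ≤ Real.exp (-(0 * 0)) * ∑ i ∈ Finset.range 1, 1 * |g i - g' i|
    simp
  · intro k i _
    simp

/-- **THE CARRIER'S MODULUS FIELD DECIDES**: the same functional with moduli `Λ ≡ 0` does NOT carry `N22At` (NE9 fails between the constant
histories `1` and `1∕2` of `Window 1`) — the slot is not vacuous. [folklore] -/
theorem not_n22At_toy_zeroModulus :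
    ¬ N22At ⟨⟨Unit, fun _ => 1, fun _ => 0, fun _ => le_rfl, Unit, Unit, fun _ _ => 0, fun _ _ => le_rfl, id⟩, Window 1, 1, 0,
      fun g _ _ => g 0, fun _ g _ _ => g 0, 1 / 2, 0, fun _ _ => 0, 1, 1, 0, 1⟩ := by
  rintro ⟨h9, -⟩
  have hg : (fun _ : ℕ => (1 : ℝ)) ∈ Window 1 := fun _ => ⟨one_pos, le_rfl⟩
  have hg' : (fun _ : ℕ => (1 / 2 : ℝ)) ∈ Window 1 := fun _ => ⟨by norm_num, by norm_num⟩
  have h := h9 _ hg _ hg' () ()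
  have h' : |(1 : ℝ) - 1 / 2| ≤ Real.exp (-(0 * 0)) * ∑ i ∈ Finset.range 1, 0 * |(1 : ℝ) - 1 / 2| := h
  norm_num at h'

/-- **R422 AT NODE LEVEL**: a rate-record predicate admitting one bundle WITHOUT `N22At` has no `S_N22`. [folklore] -/
theorem not_s_N22_of_admits (RRec : RateRecordPred N)
    (h : ∃ (F : T4Family) (D : Datum F N) (g₀ : ℕ → ℝ) (os : List (ULoop F)) (R : RateCarriers N), RRec F D g₀ os R ∧ ¬ N22At R.u3) :
    ¬ S_N22 RRec := by
  rintro hS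
  obtain ⟨F, D, g₀, os, R, hR, hn⟩ := h
  exact hn (hS F D g₀ os R hR)

/-- **VACUITY over an empty predicate**: an `RRec` with no bundle of record has `S_N22` for free — which is why the INHABITED rider and K4's
existence content `S_R00x` matter. [folklore] -/
theorem s_N22_of_empty (RRec : RateRecordPred N)
    (h : ∀ (F : T4Family) (D : Datum F N) (g₀ : ℕ → ℝ) (os : List (ULoop F)) (R : RateCarriers N), ¬ RRec F D g₀ os R) :
    S_N22 RRec :=
  fun F D g₀ os R hR => absurd hR (h F D g₀ os R)

/-! ## §4 The node's consumer faces AT THE RECORD -/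

section AtRecord

variable (RRec : RateRecordPred N)

/-- **PREFIX DEPENDENCE AT THE RECORD**: the printed words ([Balaban1987RG1] p. 256) for every bundle of record, from NE9
(`T4OutputRate.prefixDependenceOn_of_ne9`). [folklore] -/
theorem prefixDependence_at_record (h : S_N22 RRec) {F : T4Family} {D : Datum F N} {g₀ : ℕ → ℝ} {os : List (ULoop F)}
    {R : RateCarriers N} (hR : RRec F D g₀ os R) : PrefixDependenceOn R.u3.EA R.u3.W :=
  prefixDependenceOn_of_ne9 (h F D g₀ os R hR).1

/-- **THE MODULI ARE NON-NEGATIVE AT THE RECORD** (part of `FadingMemory`). [folklore] -/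
theorem moduli_nonneg_at_record (h : S_N22 RRec) {F : T4Family} {D : Datum F N} {g₀ : ℕ → ℝ} {os : List (ULoop F)}
    {R : RateCarriers N} (hR : RRec F D g₀ os R) {k i : ℕ} (hik : i ≤ k) : 0 ≤ R.u3.Λ k i :=
  ((h F D g₀ os R hR).2 k i hik).1

/-- **THE COUPLING BRACKET AT THE RECORD, UNIFORM IN THE CREATION STEP**: when the bundle's fading letter has `0 ≤ ω < 1` and two coupling
histories are `δ`-close coordinatewise, the history bracket of `u3_threeBrackets` is `≤ C₉·δ·(1 − ω)⁻¹` at EVERY creation step — what node N19's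
coupling bracket consumes (`T4OutputRate.historySum_le_of_fadingMemory`). [folklore] -/
theorem historyBracket_at_record (h : S_N22 RRec) {F : T4Family} {D : Datum F N} {g₀ : ℕ → ℝ} {os : List (ULoop F)}
    {R : RateCarriers N} (hR : RRec F D g₀ os R) (hω0 : 0 ≤ R.u3.ω) (hω1 : R.u3.ω < 1) {gA gB : ℕ → ℝ} {δ : ℝ}
    (hδ : ∀ i, |gA i - gB i| ≤ δ) (j : ℕ) :
    ∑ i ∈ Finset.range j, R.u3.Λ j i * |gA i - gB i| ≤ R.u3.C₉ * δ * (1 - R.u3.ω)⁻¹ :=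
  historySum_le_of_fadingMemory (h F D g₀ os R hR).2 hω0 hω1 hδ j

/-- **THE TWO-RUN DIFFERENCE AT THE RECORD** (NE9's own face): for every bundle of record, run A's scale-`j` term at two admissible histories differs by
at most `e^{−κd(X)}·Σ_{i<j} Λ j i·|g_i − g′_i|`. [folklore] -/
theorem ne9_at_record (h : S_N22 RRec) {F : T4Family} {D : Datum F N} {g₀ : ℕ → ℝ} {os : List (ULoop F)}
    {R : RateCarriers N} (hR : RRec F D g₀ os R) {g g' : ℕ → ℝ} (hg : g ∈ R.u3.W) (hg' : g' ∈ R.u3.W) (U : R.u3.C.BgA) (X : R.u3.C.Dom) :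
    |R.u3.EA g U X - R.u3.EA g' U X| ≤
      Real.exp (-(R.u3.κ * R.u3.C.d X)) * ∑ i ∈ Finset.range (R.u3.C.scale X), R.u3.Λ (R.u3.C.scale X) i * |g i - g' i| :=
  (h F D g₀ os R hR).1 g hg g' hg' U X

end AtRecord

end YMDAG.N22

end
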